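import Literature.Probability.RandomPlanarGeometry.USTPeanoDomain
import HarnessLib

/-!
# Cyclic edges and vertices of the boundary polygon of `D(α, β, a, b)`

Index-free access to the boundary vertex cycle
`boundaryVerts α β a b = [a, α_a, …, α_b, b, β_b, …, β_a]` (`USTPeanoDomain.lean`) of the
lattice domains of [LSW04] §4.1: the simplicity criterion (`PolygonStarShaped.lean`), the inside
tests (`PolygonWinding.lean`) and the approximation bounds for `USTPeano.Domain` instances are all
stated per cyclic edge `(l[k], l[(k+1) % N])` or per vertex `l[k]`; here they are reduced to
statements about consecutive points of `α`, of `β` (traversed backwards), the four junctions at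
`a` and `b`, and membership in `α`, `β`, `{a, b}` — so that concrete (large) lattice paths can be
handled through `List.IsChain` / `List.Mem` over `map`, `append`, `reverse`, without index
arithmetic:

* `forall_getElem_mod_of_isChain` — a relation holding along a list (`List.IsChain`) and from
  its last to its first element holds for all cyclic consecutive pairs;
* `USTPeano.boundaryVerts_cyclic` — the reduction for the boundary cycle;
* `USTPeano.mem_boundaryVerts_iff`, `USTPeano.forall_getElem_boundaryVerts` — the vertices.
-/

namespace Literature.Probability.RandomPlanarGeometry

open List

/-- **Cyclic consecutive pairs from a chain that closes up**: if `R` holds between consecutive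
elements of `l ≠ []` and between the last and the first element, it holds for every cyclic pair
`(l[k], l[(k + 1) % N])`. [folklore] -/
theorem forall_getElem_mod_of_isChain {X : Type*} {R : X → X → Prop} {l : List X} (hl : l ≠ [])
    (hc : l.IsChain R) (hwrap : R (l.getLast hl) (l.head hl)) (k : ℕ) (hk : k < l.length) :
    R l[k] (l[(k + 1) % l.length]'(Nat.mod_lt _ (List.length_pos_iff.2 hl))) := by
  rcases Nat.lt_or_ge (k + 1) l.length with h | h
  · have e : l[(k + 1) % l.length]'(Nat.mod_lt _ (List.length_pos_iff.2 hl)) = l[k + 1] :=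
      getElem_congr_idx (Nat.mod_eq_of_lt h)
    rw [e]
    exact hc.getElem k h
  · have hk1 : k + 1 = l.length := by omega
    have e : l[(k + 1) % l.length]'(Nat.mod_lt _ (List.length_pos_iff.2 hl)) = l[0] :=
      getElem_congr_idx (by rw [hk1, Nat.mod_self])
    have e0 : l[0]'(List.length_pos_iff.2 hl) = l.head hl := (List.head_eq_getElem hl).symm
    have ek : l[k] = l.getLast hl := by
      rw [List.getLast_eq_getElem]
      exact getElem_congr_idx (by omega)
    rw [e, e0, ek]
    exact hwrap

namespace USTPeano

variable {α β : List (ℤ × ℤ)} {a b : ℤ × ℤ}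

/-- **The vertices of the boundary cycle** are `a`, the points of `α`, `b`, and the points of
`β`. [folklore] -/
theorem mem_boundaryVerts_iff {v : ℂ} :
    v ∈ boundaryVerts α β a b ↔
      v = peanoPt a ∨ v ∈ α.map primalPt ∨ v = peanoPt b ∨ v ∈ β.map dualPt := by
  simp only [boundaryVerts, mem_cons, mem_append, mem_reverse]

/-- A property of all of `a`, `b`, the points of `α` and the points of `β` holds at every vertex
of the boundary cycle. [folklore] -/
theorem forall_getElem_boundaryVerts {Q : ℂ → Prop} (ha : Q (peanoPt a)) (hb : Q (peanoPt b))
    (hα : ∀ v ∈ α, Q (primalPt v)) (hβ : ∀ v ∈ β, Q (dualPt v)) (k : ℕ)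
    (hk : k < (boundaryVerts α β a b).length) : Q ((boundaryVerts α β a b)[k]) := by
  have hmem := List.getElem_mem hk
  rcases mem_boundaryVerts_iff.1 hmem with h | h | h | h
  · rw [h]; exact ha
  · obtain ⟨v, hv, hv'⟩ := List.mem_map.1 h
    rw [← hv']; exact hα v hv
  · rw [h]; exact hb
  · obtain ⟨v, hv, hv'⟩ := List.mem_map.1 h
    rw [← hv']; exact hβ v hv

/-- **The cyclic edges of the boundary cycle**: a relation holds along every cyclic edge
`(l[k], l[(k+1) % N])` of `boundaryVerts α β a b` as soon as it holds (1) from `a` to `α_a`,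
(2) along `α`, (3) from `α_b` to `b`, (4) from `b` to `β_b`, (5) along `β` traversed backwards,
(6) from `β_a` to `a`. [folklore] -/
theorem boundaryVerts_cyclic {R : ℂ → ℂ → Prop} (hα : α ≠ []) (hβ : β ≠ [])
    (h1 : R (peanoPt a) (primalPt (α.head hα)))
    (h2 : (α.map primalPt).IsChain R)
    (h3 : R (primalPt (α.getLast hα)) (peanoPt b))
    (h4 : R (peanoPt b) (dualPt (β.getLast hβ)))
    (h5 : (β.map dualPt).IsChain (fun u v ↦ R v u))
    (h6 : R (dualPt (β.head hβ)) (peanoPt a))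
    (k : ℕ) (hk : k < (boundaryVerts α β a b).length) :
    R ((boundaryVerts α β a b)[k])
      ((boundaryVerts α β a b)[(k + 1) % (boundaryVerts α β a b).length]'(Nat.mod_lt _ (by simp))) := by
  have hne : boundaryVerts α β a b ≠ [] := by simp [boundaryVerts]
  refine forall_getElem_mod_of_isChain hne ?_ ?_ k hk
  · -- the chain along the list
    simp only [boundaryVerts]
    rw [List.isChain_cons]
    refine ⟨?_, ?_⟩
    · intro y hy
      obtain ⟨x, l', hx⟩ := List.exists_cons_of_ne_nil hα
      subst hx
      simp at hy
      subst hy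
      simpa using h1
    · rw [List.isChain_append]
      refine ⟨h2, ?_, ?_⟩
      · rw [List.isChain_cons]
        refine ⟨?_, List.isChain_reverse.2 h5⟩
        intro y hy
        have hβ' : (β.map dualPt).reverse ≠ [] := by simpa using hβ
        rw [List.head?_eq_some_head hβ'] at hy
        simp only [Option.mem_def, Option.some.injEq] at hy
        subst hy
        rw [List.head_reverse]
        simpa [List.getLast_map] using h4
      · intro x hx y hy
        have hα' : α.map primalPt ≠ [] := by simpa using hα
        rw [List.getLast?_eq_getLast_of_ne_nil hα'] at hx
        simp only [Option.mem_def, Option.some.injEq, List.head?_cons] at hx hy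
        subst hx; subst hy
        simpa [List.getLast_map] using h3
  · -- closing up: from `β_a` (the last vertex) to `a`
    have hβ' : (β.map dualPt).reverse ≠ [] := by simpa using hβ
    have hlast : (boundaryVerts α β a b).getLast hne = dualPt (β.head hβ) := by
      simp [boundaryVerts, List.getLast_cons hβ', List.getLast_reverse,
        List.head_map]
    have hhead : (boundaryVerts α β a b).head hne = peanoPt a := by simp [boundaryVerts]
    rw [hlast, hhead]
    exact h6

/-- The same reduction for a relation given on the index lists (primal points of `α`, dual
points of `β`). [folklore] -/
theorem boundaryVerts_cyclic' {R : ℂ → ℂ → Prop} (hα : α ≠ []) (hβ : β ≠ [])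
    (h1 : R (peanoPt a) (primalPt (α.head hα)))
    (h2 : α.IsChain fun u v ↦ R (primalPt u) (primalPt v))
    (h3 : R (primalPt (α.getLast hα)) (peanoPt b))
    (h4 : R (peanoPt b) (dualPt (β.getLast hβ)))
    (h5 : β.IsChain fun u v ↦ R (dualPt v) (dualPt u))
    (h6 : R (dualPt (β.head hβ)) (peanoPt a))
    (k : ℕ) (hk : k < (boundaryVerts α β a b).length) :
    R ((boundaryVerts α β a b)[k])
      ((boundaryVerts α β a b)[(k + 1) % (boundaryVerts α β a b).length]'(Nat.mod_lt _ (by simp))) :=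
  boundaryVerts_cyclic hα hβ h1 ((List.isChain_map _).2 h2) h3 h4 ((List.isChain_map _).2 h5) h6 k hk

end USTPeano

end Literature.Probability.RandomPlanarGeometry
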